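import Summits.ResolutionOfSingularities.ResolutionOfSingularities.Theorems.PurelyInseparableDim4ResConeLSectorKill
import Summits.ResolutionOfSingularities.ResolutionOfSingularities.Theorems.PurelyInseparableDim4ResConeLayerBirths
import Summits.ResolutionOfSingularities.ResolutionOfSingularities.Theorems.PurelyInseparableDim4ResConeHeavyEntryFrame
import HarnessLib
import HarnessLib.Audit.Tags

/-!
# Purely inseparable four-folds — THE L-SECTOR LETTER CHANGE KILL FOR EVERY PRIME AND EVERY SHADE
# (cell `res-dim4-pi`, K2(p) lane, B rows = power cones `e_G = 3`; the `∀ p` edition of `…ResConeLSectorKill`)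

[OURS · counted 0 · cell `res-dim4-pi` · K2(p) lane (holder res-dim4-p-12 g5, text S4 «structure at e = 3» / B-LF, B-LOSSY;
template = the holder's K24a-R2 file `…ResConeLSectorKill`, p693743, which is the case `p = 5`, `d = 3`, boundary `x_A x_B x_ν`)
· seat res-dim4-p-5 g6.]  Nothing here proves any TAIL(p, d, 3), K2(7), K2(p), `NoIsolatedTrap p p` or resolution of
singularities in dimension ≥ 4 / characteristic `p` — NOT proved; a statement about OUR frame's `Step0` walk.  AI kernel work,
weaker than expert review.

SETTING (the FROZEN L-SECTOR of a power-cone tail, res-dim4-p-1 g6 `exists_frozen_formSupport_of_L`): the residual cone is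
`a·ℓ^d` with `ℓ` supported on a set of PERMANENT letters, so at two consecutive steps with charts `A` then `B` both cones live on a
set `Kset` of letters that are KEPT (neither charted nor translated) through both steps, `A, B ∉ Kset`.  Write `o = ord₀ F₀`,
`o₁ = ord₀ F₁`, `r` = boundary weights at the first state, `R = Σ_{i ∈ Kset} r_i`.  Pure exponent bookkeeping:
* §1 `exists_monomial_of_mem_support_shear`, **`exists_source_of_mem_support_step_kept`** — the SOURCE LAW of one point step at a
  chart point `b` (`b_j = 0`): every monomial `x^T` of the new `F` comes from a monomial `x^m` of `F` with `T_j = |m| − q` and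
  `T_i ≥ m_i` for every letter `i ≠ j` that is not translated (`b_i = 0`) (shear `x_i ↦ x_i + b_i x_j`, chart law, cleaning only
  deletes; res-dim4-p-12 g3's `exists_of_mem_support_step`).
* §2 **`le_sum_after_two_steps`** — THE COUNT: if the degree-`o` monomials of `F₀` carry `Kset`-mass `≥ R + 1` and the degree-`o₁`
  monomials `E` of `F₁` have `E_A + Σ_{Kset} E ≥ (o − q) + R + 2` (both read off the cones: the cone's own degree `d ≥ 2` sits on
  `Kset`), then EVERY monomial `T` of `F₂` has `T_A + T_B + Σ_{Kset} T + 2q ≥ o₁ + o + R + 2`.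
* §3 **`not_isIsolated_after_two_steps`** — hence if `3q ≤ o₁ + o + R + 2` and some letter lies outside `{A, B} ∪ Kset` (a free or
  lost letter), the coordinate subspace spanned by those outside letters is `q`-fold: the third state is NOT an isolated `q`-fold
  point.  **`not_isIsolated_after_lSector_change_prime`** — the same with the hypotheses read off the residual power cones
  `resForm sᵢ = C aᵢ * (Σ ℓᵢ x)^d`, `ℓ₀`, `ℓ₁` vanishing off `Kset`.
NUMEROLOGY (`o₁ = 2o − q − r_A − W₀`, `W₀` = weight lost at the first step): the kill condition reads `3o + R + 2 ≥ 4q + r_A + W₀`;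
loss-free with one free letter: `4|r| + 3d + 2 ≥ 4q + 2 r_A + r_B` — at `(5, 3)` with weights `(1,1,1)` this is `23 ≥ 23`, the
template; on the stationary two-slot shape `(n, n) + w`, `n + w + d = q`, it reads `n + 2 ≥ d`.  NOT here: the light stationary
classes `n ≤ d − 3` (no exponent count kills them: `x_A^{n+1} x_B^{n+1} x_ν^{w} x_φ^{3}` is corner-stationary), the chain-level
corollary.
[cite: CossartJannsenSaito2020, Thm. 3.10(4), Thm. 3.14] [cite: Hauser2010, §§F–G (chart expressions of a point blowup; cleaning), §I (P⁺)]
bears_on: LADDER-RESOLUTION:D157-DOOR2 (res-dim4-pi · K2(p) B rows · L-sector letter change kill ∀ p).  Supports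
stmt-ResolutionOfSingularities-16155 (helper).
-/

set_option linter.dupNamespace false -- mandated namespace of this single-conjunct summit

noncomputable section

namespace Summit.ResolutionOfSingularities.ResolutionOfSingularities.Theorems.PIDim4

namespace ResCone

open MvPolynomial Finset
open Literature.AlgebraicGeometry.Resolution
open Literature.AlgebraicGeometry.Resolution.CentreBlowup
open Literature.AlgebraicGeometry.Resolution.Hauser2010
open Literature.AlgebraicGeometry.Resolution.HauserPerlega2019

variable {K : Type} [Field K] [DecidableEq K]

/-! ## 1. The source law of one point step -/

omit [DecidableEq K] in
/-- Every monomial of `shear j b F` is a monomial of `shear j b (x^m)` for some monomial `x^m` of `F` (linearity).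
[folklore] [cite: Hauser2010, §I (definition of P⁺)] -/
theorem exists_monomial_of_mem_support_shear (j : Fin 4) (b : Fin 4 → K) (F : MvPolynomial (Fin 4) K)
    {e : Fin 4 →₀ ℕ} (he : e ∈ (shear j b F).support) :
    ∃ m ∈ F.support, e ∈ (shear j b (monomial m (1 : K))).support := by
  classical
  have hF : shear j b F = ∑ m ∈ F.support, shear j b (monomial m (coeff m F)) := by
    conv_lhs => rw [F.as_sum]
    unfold shear
    rw [map_sum]
  rw [hF] at he
  obtain ⟨m, hm, hem⟩ := Finset.mem_biUnion.mp (Finset.mem_of_subset (support_sum) he)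
  refine ⟨m, hm, ?_⟩
  have hmul : shear j b (monomial m (coeff m F)) = C (coeff m F) * shear j b (monomial m (1 : K)) := by
    rw [← mul_one (coeff m F), ← C_mul_monomial, mul_one]
    unfold shear
    rw [map_mul, aeval_C]
    rfl
  rw [hmul, MvPolynomial.mem_support_iff, coeff_C_mul] at hem
  rw [MvPolynomial.mem_support_iff]
  exact fun h => hem (by rw [h, mul_zero])

/-- **SOURCE LAW of a point step** at the chart point `b` of the `x_j`-chart (`b_j = 0`, `q ≤ ord F`): every monomial `x^T` of
the new `F` comes from a monomial `x^m` of `F` with `T_j = |m| − q` and `m_i ≤ T_i` for every untranslated letter `i ≠ j`.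
[OURS · bookkeeping] [cite: Hauser2010, §§F–G, §I] -/
theorem exists_source_of_mem_support_step_kept (q : ℕ) (j : Fin 4) {b : Fin 4 → K} (hbj : b j = 0) (s : State K)
    (hq : (q : ℕ∞) ≤ ordAlong Finset.univ s.F) {T : Fin 4 →₀ ℕ}
    (hT : T ∈ (CentreBlowup.step q Finset.univ j b s).F.support) :
    ∃ m ∈ s.F.support, T j = m.degree - q ∧ ∀ i, i ≠ j → b i = 0 → m i ≤ T i := by
  classical
  obtain ⟨e, he, heT, -⟩ := exists_of_mem_support_step q j hbj s hq hT
  obtain ⟨m, hm, hem⟩ := exists_monomial_of_mem_support_shear j b s.F he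
  have hdeg : e.degree = m.degree := by
    have h := Straightening.isHomogeneous_shear_monomial j b m (1 : K) (MvPolynomial.mem_support_iff.mp hem)
    rwa [weight_one_eq_degree] at h
  have hle := le_of_mem_support_shear_monomial j hbj m hem
  refine ⟨m, hm, ?_, fun i hij hbi => ?_⟩
  · rw [← heT, chartExponent_univ_apply_self, hdeg]
  · rw [← heT, chartExponent_apply_of_ne q _ hij]
    have h := hle i
    rw [filter_apply_eq, if_pos hbi] at h
    exact h

/-! ## 2. The count over two steps -/

/-- **THE COUNT.**  Two point steps, charts `A` then `B` (`A ≠ B`), chart points `b₀` (`b₀ A = 0`) and `b₁` (`b₁ B = 0 = b₁ A`),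
a set `Kset ∌ A, B` of letters translated at neither step, weights `r` below the `Kset`-exponents of `F₀`, `R = Σ_{Kset} r`;
all monomials of `F₀` have degree `≥ o` and the degree-`o` ones carry `Kset`-mass `≥ R + 1`; all monomials of `F₁` have degree
`≥ o₁` and the degree-`o₁` ones satisfy `E_A + Σ_{Kset} E ≥ (o − q) + R + 2`.  Then every monomial `T` of `F₂` satisfies
`o₁ + o + R + 2 ≤ T_A + T_B + Σ_{Kset} T + 2q`. [OURS] [cite: Hauser2010, §§F–G, §I] -/
theorem le_sum_after_two_steps (q : ℕ) {A B : Fin 4} (hAB : A ≠ B) {Kset : Finset (Fin 4)} (hAK : A ∉ Kset)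
    (hBK : B ∉ Kset) (s₀ : State K) {b₀ b₁ : Fin 4 → K} (hb₀A : b₀ A = 0) (hb₀K : ∀ i ∈ Kset, b₀ i = 0)
    (hb₁B : b₁ B = 0) (hb₁A : b₁ A = 0) (hb₁K : ∀ i ∈ Kset, b₁ i = 0) (r : Fin 4 → ℕ) {o o₁ R : ℕ}
    (hR : R = ∑ i ∈ Kset, r i) (hq₀ : (q : ℕ∞) ≤ ordAlong Finset.univ s₀.F)
    (h0deg : ∀ D ∈ s₀.F.support, o ≤ D.degree) (h0K : ∀ D ∈ s₀.F.support, ∀ i ∈ Kset, r i ≤ D i)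
    (h0init : ∀ D ∈ s₀.F.support, D.degree = o → R + 1 ≤ ∑ i ∈ Kset, D i)
    {s₁ : State K} (hs₁ : s₁ = CentreBlowup.step q Finset.univ A b₀ s₀)
    (hq₁ : (q : ℕ∞) ≤ ordAlong Finset.univ s₁.F) (h1deg : ∀ E ∈ s₁.F.support, o₁ ≤ E.degree)
    (h1init : ∀ E ∈ s₁.F.support, E.degree = o₁ → o - q + R + 2 ≤ E A + ∑ i ∈ Kset, E i)
    {s₂ : State K} (hs₂ : s₂ = CentreBlowup.step q Finset.univ B b₁ s₁) :
    ∀ T ∈ s₂.F.support, o₁ + o + R + 2 ≤ T A + T B + ∑ i ∈ Kset, T i + 2 * q := by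
  intro T hT
  subst hs₂
  obtain ⟨E, hE, hTB, hTkeep⟩ := exists_source_of_mem_support_step_kept q B hb₁B s₁ hq₁ hT
  have hTA : E A ≤ T A := hTkeep A hAB hb₁A
  have hTK : ∑ i ∈ Kset, E i ≤ ∑ i ∈ Kset, T i :=
    Finset.sum_le_sum fun i hi => hTkeep i (fun h => hBK (h ▸ hi)) (hb₁K i hi)
  have hTBq : E.degree ≤ T B + q := by rw [hTB]; omega
  have hEdeg := h1deg E hE
  by_cases hEo : E.degree = o₁
  · have h := h1init E hE hEo
    omega
  · subst hs₁
    obtain ⟨m, hm, hEA, hEkeep⟩ := exists_source_of_mem_support_step_kept q A hb₀A s₀ hq₀ hE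
    have hEK : ∑ i ∈ Kset, m i ≤ ∑ i ∈ Kset, E i :=
      Finset.sum_le_sum fun i hi => hEkeep i (fun h => hAK (h ▸ hi)) (hb₀K i hi)
    have hEAq : m.degree ≤ E A + q := by rw [hEA]; omega
    have hmdeg := h0deg m hm
    by_cases hmo : m.degree = o
    · have h := h0init m hm hmo
      omega
    · have hmK : R ≤ ∑ i ∈ Kset, m i := by
        rw [hR]
        exact Finset.sum_le_sum fun i hi => h0K m hm i hi
      omega

/-! ## 3. The kill -/

omit [DecidableEq K] in
/-- A coordinate subspace `V(x_i : i ∈ S)`, `S ≠ univ`, along which `F` has order `≥ q` refutes isolation (exponent form).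
[folklore] -/
theorem not_isIsolated_of_forall_le_sum {q : ℕ} {S : Finset (Fin 4)} (hS : S ≠ Finset.univ)
    {F : MvPolynomial (Fin 4) K} (h : ∀ T ∈ F.support, q ≤ ∑ i ∈ S, T i) : ¬ IsIsolated q F := by
  refine IsolationCert.not_isIsolated_of_le_ordAlong_of_ne_univ (S := S) ?_ hS
  exact le_ordAlong_iff.mpr fun T hT => by exact_mod_cast h T hT

/-- **THE L-SECTOR LETTER CHANGE KILL, exponent dress (every `q`).**  In the situation of `le_sum_after_two_steps`, if
`3q ≤ o₁ + o + R + 2` and some letter lies outside `{A, B} ∪ Kset` (a free or lost letter), the third state is NOT an isolated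
`q`-fold point: the coordinate subspace `V(x_A, x_B, x_{Kset})` is `q`-fold. [OURS] [cite: Hauser2010, §§F–G, §I] -/
theorem not_isIsolated_after_two_steps (q : ℕ) {A B : Fin 4} (hAB : A ≠ B) {Kset : Finset (Fin 4)} (hAK : A ∉ Kset)
    (hBK : B ∉ Kset) (hS : insert A (insert B Kset) ≠ Finset.univ) (s₀ : State K) {b₀ b₁ : Fin 4 → K}
    (hb₀A : b₀ A = 0) (hb₀K : ∀ i ∈ Kset, b₀ i = 0) (hb₁B : b₁ B = 0) (hb₁A : b₁ A = 0)
    (hb₁K : ∀ i ∈ Kset, b₁ i = 0) (r : Fin 4 → ℕ) {o o₁ R : ℕ} (hR : R = ∑ i ∈ Kset, r i)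
    (hkill : 3 * q ≤ o₁ + o + R + 2) (hq₀ : (q : ℕ∞) ≤ ordAlong Finset.univ s₀.F)
    (h0deg : ∀ D ∈ s₀.F.support, o ≤ D.degree) (h0K : ∀ D ∈ s₀.F.support, ∀ i ∈ Kset, r i ≤ D i)
    (h0init : ∀ D ∈ s₀.F.support, D.degree = o → R + 1 ≤ ∑ i ∈ Kset, D i)
    {s₁ : State K} (hs₁ : s₁ = CentreBlowup.step q Finset.univ A b₀ s₀)
    (hq₁ : (q : ℕ∞) ≤ ordAlong Finset.univ s₁.F) (h1deg : ∀ E ∈ s₁.F.support, o₁ ≤ E.degree)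
    (h1init : ∀ E ∈ s₁.F.support, E.degree = o₁ → o - q + R + 2 ≤ E A + ∑ i ∈ Kset, E i)
    {s₂ : State K} (hs₂ : s₂ = CentreBlowup.step q Finset.univ B b₁ s₁) :
    ¬ IsIsolated q s₂.F := by
  have hcount := le_sum_after_two_steps q hAB hAK hBK s₀ hb₀A hb₀K hb₁B hb₁A hb₁K r hR hq₀ h0deg h0K h0init hs₁
    hq₁ h1deg h1init hs₂
  refine not_isIsolated_of_forall_le_sum hS fun T hT => ?_
  have h := hcount T hT
  rw [Finset.sum_insert (by simp [hAB, hAK]), Finset.sum_insert hBK]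
  omega

/-! ## 4. Cone dress -/

omit [DecidableEq K] in
/-- **Reading the count's hypotheses off a power cone supported on `Kset`.**  If `x^r ∣ F`, `ord₀ F = o = |r| + d` and the residual
cone is `a · (Σ ℓ_k x_k)^d` with `ℓ` vanishing OFF `Kset`, then every degree-`o` monomial `D` of `F` has
`Σ_{Kset} D = Σ_{Kset} r + d` and `D_i = r_i` off `Kset`. [OURS · bookkeeping] [folklore] -/
theorem sum_eq_of_cone_supported {s : State K} {o d : ℕ} (ho : ordZero s.F = o) (hr : ∀ D ∈ s.F.support, s.r ≤ D)
    (hrd : s.r.degree + d = o) {a : K} {ℓ : Fin 4 → K} (hform : resForm s = C a * (∑ i, C (ℓ i) * X i) ^ d)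
    {Kset : Finset (Fin 4)} (hℓ : ∀ i, i ∉ Kset → ℓ i = 0) {D : Fin 4 →₀ ℕ} (hD : D ∈ s.F.support)
    (hdeg : D.degree = o) :
    (∑ i ∈ Kset, D i = ∑ i ∈ Kset, s.r i + d) ∧ ∀ i, i ∉ Kset → D i = s.r i := by
  classical
  obtain ⟨hμ, hsum⟩ := tsub_mem_support_resForm ho hr hD hdeg
  rw [hform] at hμ
  have hoff : ∀ i, i ∉ Kset → (D - s.r) i = 0 := fun i hi =>
    apply_eq_zero_of_mem_support_C_mul_linearForm_pow (hℓ i hi) hμ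
  have hμdeg : (D - s.r).degree = d := by
    have h : s.r.degree + (D - s.r).degree = o := by rw [← map_add, hsum, hdeg]
    omega
  refine ⟨?_, fun i hi => ?_⟩
  · have hsplit : ∑ i ∈ Kset, D i = ∑ i ∈ Kset, s.r i + ∑ i ∈ Kset, (D - s.r) i := by
      rw [← Finset.sum_add_distrib]
      refine Finset.sum_congr rfl fun i _ => ?_
      have h := congrArg (fun m : Fin 4 →₀ ℕ => m i) hsum
      simp only [Finsupp.add_apply] at h
      omega
    rw [hsplit]
    congr 1
    rw [← hμdeg, Finsupp.degree_eq_sum]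
    exact Finset.sum_subset (Finset.subset_univ _) fun i _ hi => hoff i hi
  · have h := congrArg (fun m : Fin 4 →₀ ℕ => m i) hsum
    simp only [Finsupp.add_apply] at h
    rw [hoff i hi] at h
    omega

/-- **THE L-SECTOR LETTER CHANGE KILL FOR EVERY PRIME AND EVERY SHADE (cone dress).**  Two point steps of exponent `q`, charts
`A` then `B` (`A ≠ B`), chart points `b₀` (`b₀ A = 0`), `b₁` (`b₁ B = 0`, `b₁ A = 0`); a set `Kset ∌ A, B` of letters translated
at neither step and missing some letter besides `A`, `B`; at `s₀`: `x^{r₀} ∣ F₀`, `ord₀ F₀ = o = |r₀| + d`, residual cone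
`a₀ (Σ ℓ₀ x)^d` with `ℓ₀` vanishing off `Kset`; at `s₁`: `x^{r₁} ∣ F₁`, `ord₀ F₁ = o₁ = |r₁| + d`, residual cone `a₁ (Σ ℓ₁ x)^d`
with `ℓ₁` vanishing off `Kset`, `r₁ A + q = o` (the new exceptional weight) and `r₁ = r₀` on `Kset`; `2 ≤ d`, `q ≤ o, o₁`, and the
NUMERIC KILL CONDITION `3q ≤ o₁ + o + Σ_{Kset} r₀ + 2`.  Then `s₂` is NOT an isolated `q`-fold point.  (Frozen L-sector: `Kset` ⊇
the frozen form support; `(q, d) = (5, 3)`, weights `(1,1,1)`, `Kset = {ν}`: `15 ≤ 6 + 6 + 1 + 2` — the template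
`not_isIsolated_after_lSector_change_of_forms`.) [OURS] [cite: CossartJannsenSaito2020, Thm. 3.14] [cite: Hauser2010, §§F–G, §I] -/
theorem not_isIsolated_after_lSector_change_prime (q : ℕ) {A B : Fin 4} (hAB : A ≠ B) {Kset : Finset (Fin 4)}
    (hAK : A ∉ Kset) (hBK : B ∉ Kset) (hS : insert A (insert B Kset) ≠ Finset.univ) (s₀ : State K) {b₀ b₁ : Fin 4 → K}
    (hb₀A : b₀ A = 0) (hb₀K : ∀ i ∈ Kset, b₀ i = 0) (hb₁B : b₁ B = 0) (hb₁A : b₁ A = 0)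
    (hb₁K : ∀ i ∈ Kset, b₁ i = 0) {o o₁ d : ℕ} (hd : 2 ≤ d) (hqo : q ≤ o) (hqo₁ : q ≤ o₁)
    (ho₀ : ordZero s₀.F = o) (hr₀ : ∀ D ∈ s₀.F.support, s₀.r ≤ D) (hrd₀ : s₀.r.degree + d = o)
    {a₀ : K} {ℓ₀ : Fin 4 → K} (hform₀ : resForm s₀ = C a₀ * (∑ i, C (ℓ₀ i) * X i) ^ d)
    (hℓ₀ : ∀ i, i ∉ Kset → ℓ₀ i = 0)
    {s₁ : State K} (hs₁ : s₁ = CentreBlowup.step q Finset.univ A b₀ s₀)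
    (ho₁ : ordZero s₁.F = o₁) (hr₁ : ∀ E ∈ s₁.F.support, s₁.r ≤ E) (hrd₁ : s₁.r.degree + d = o₁)
    (hr₁A : s₁.r A + q = o) (hr₁K : ∀ i ∈ Kset, s₁.r i = s₀.r i)
    {a₁ : K} {ℓ₁ : Fin 4 → K} (hform₁ : resForm s₁ = C a₁ * (∑ i, C (ℓ₁ i) * X i) ^ d)
    (hℓ₁ : ∀ i, i ∉ Kset → ℓ₁ i = 0)
    (hkill : 3 * q ≤ o₁ + o + ∑ i ∈ Kset, s₀.r i + 2)
    {s₂ : State K} (hs₂ : s₂ = CentreBlowup.step q Finset.univ B b₁ s₁) :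
    ¬ IsIsolated q s₂.F := by
  have hq₀ : (q : ℕ∞) ≤ ordAlong Finset.univ s₀.F := by
    refine le_ordAlong_iff.mpr fun D hD => ?_
    rw [degIn_univ]
    exact_mod_cast le_trans hqo (le_degree_of_mem_support_of_ordZero ho₀ hD)
  have hq₁ : (q : ℕ∞) ≤ ordAlong Finset.univ s₁.F := by
    refine le_ordAlong_iff.mpr fun E hE => ?_
    rw [degIn_univ]
    exact_mod_cast le_trans hqo₁ (le_degree_of_mem_support_of_ordZero ho₁ hE)
  refine not_isIsolated_after_two_steps q hAB hAK hBK hS s₀ hb₀A hb₀K hb₁B hb₁A hb₁K (fun i => s₀.r i) rfl hkill hq₀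
    (fun D hD => le_degree_of_mem_support_of_ordZero ho₀ hD) (fun D hD i _ => hr₀ D hD i) (fun D hD hdeg => ?_) hs₁ hq₁
    (fun E hE => le_degree_of_mem_support_of_ordZero ho₁ hE) (fun E hE hdeg => ?_) hs₂
  · have h := (sum_eq_of_cone_supported ho₀ hr₀ hrd₀ hform₀ hℓ₀ hD hdeg).1
    omega
  · obtain ⟨hsum, hoff⟩ := sum_eq_of_cone_supported ho₁ hr₁ hrd₁ hform₁ hℓ₁ hE hdeg
    have hA : E A + q = o := by rw [hoff A hAK]; exact hr₁A
    have hK : ∑ i ∈ Kset, s₁.r i = ∑ i ∈ Kset, s₀.r i := Finset.sum_congr rfl fun i hi => hr₁K i hi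
    have hKE : ∑ i ∈ Kset, E i = ∑ i ∈ Kset, s₀.r i + d := by rw [hsum, hK]
    omega

/-! ## 5. On a tail -/

/-- **THE L-SECTOR LETTER CHANGE KILL ON A TAIL (every prime `p`, every shade `d ≥ 2`).**  A witnessed isolated above-floor
`Step0 p` chain with `x^{r₀} ∣ F₀` and constant shade `d` from `k₀`, whose residual cones are `a_k (Σ ℓ_k x)^d` (as delivered by
`chain_powerCone_package` on a power-cone tail), cannot pass two consecutive steps `k`, `k + 1` (`k ≥ k₀`) with DIFFERENT charts
`j k ≠ j (k+1)` such that, for a set `Kset` of letters avoiding both charts and missing some further letter, (i) both forms `ℓ k`,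
`ℓ (k+1)` vanish off `Kset` (FROZEN L-SECTOR: the cone lives on permanent letters), (ii) no letter of `Kset` is translated at either step
and `j k` is not translated at step `k + 1`, and (iii) `3p ≤ (|r_{k+1}| + d) + (|r_k| + d) + Σ_{Kset} r_k + 2` — for then `c (k+2)`
would not be isolated.  Loss-free with one free letter: (iii) is `4|r_k| + 3d + 2 ≥ 4p + 2 r_k(j k) + r_k(j (k+1))`; on res-dim4-p-2's
frozen twins `(n, n) + w` (`n + w + d = p`) it is `n + 2 ≥ d`. [OURS] [cite: CossartJannsenSaito2020, Thm. 3.10(4), Thm. 3.14]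
[cite: HauserPerlega2019PRIMS, §2 (transform D′ of D)] -/
theorem lSector_change_false (p : ℕ) [Fact p.Prime] [CharP K p] {c : ℕ → State K} {j : ℕ → Fin 4}
    {b : ℕ → Fin 4 → K} (hc : ∀ k, IsIsolated p (c k).F ∧ Step0 p (c k) (c (k + 1)))
    (hw : FreeTail.IsWitnessedChain p c j b) (hr0 : ∀ e ∈ (c 0).F.support, (c 0).r ≤ e)
    (hfloor : ∀ k, ordZero (c k).F ≠ p) {k₀ d : ℕ} (hd : 2 ≤ d) (hshade : ∀ k, k₀ ≤ k → (c k).shade = (d : ℕ∞))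
    {ℓ : ℕ → Fin 4 → K} {a : ℕ → K} (hform : ∀ k, k₀ ≤ k → resForm (c k) = C (a k) * (∑ i, C (ℓ k i) * X i) ^ d)
    {k : ℕ} (hk : k₀ ≤ k) {Kset : Finset (Fin 4)} (hjK : j k ∉ Kset) (hj'K : j (k + 1) ∉ Kset)
    (hchange : j k ≠ j (k + 1)) (hS : insert (j k) (insert (j (k + 1)) Kset) ≠ Finset.univ)
    (hℓ₀ : ∀ i, i ∉ Kset → ℓ k i = 0) (hℓ₁ : ∀ i, i ∉ Kset → ℓ (k + 1) i = 0)
    (hbK : ∀ i ∈ Kset, b k i = 0) (hb'K : ∀ i ∈ Kset, b (k + 1) i = 0) (hb'A : b (k + 1) (j k) = 0)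
    (hkill : 3 * p ≤ ((c (k + 1)).r.degree + d) + ((c k).r.degree + d) + ∑ i ∈ Kset, (c k).r i + 2) :
    False := by
  obtain ⟨ho₀, hpo₀, -⟩ := tail_ordZero_eq hc hr0 hfloor hshade hk
  obtain ⟨ho₁, hpo₁, -⟩ := tail_ordZero_eq hc hr0 hfloor hshade (show k₀ ≤ k + 1 by omega)
  obtain ⟨-, hlaw, -, -, -⟩ := tail_weights_laws hc hw hr0 hfloor hshade
  have hr₁ := hlaw k hk
  refine absurd (hc (k + 2)).1 (not_isIsolated_after_lSector_change_prime p hchange hjK hj'K hS (c k) (hw k).2.1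
    hbK (hw (k + 1)).2.1 hb'A hb'K hd hpo₀.le hpo₁.le ho₀ (IsolatedBand.isolated_chain_forall_le hc hr0 k) rfl
    (hform k hk) hℓ₀ (hw k).2.2.2.2 ho₁ (IsolatedBand.isolated_chain_forall_le hc hr0 (k + 1)) rfl ?_ ?_
    (hform (k + 1) (by omega)) hℓ₁ hkill (hw (k + 1)).2.2.2.2)
  · rw [hr₁, Finsupp.coe_update, Function.update_self]
    omega
  · intro i hi
    have hij : i ≠ j k := fun h => hjK (h ▸ hi)
    rw [hr₁, Finsupp.coe_update, Function.update_of_ne hij, Finsupp.filter_apply, if_pos (hbK i hi)]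

end ResCone

end Summit.ResolutionOfSingularities.ResolutionOfSingularities.Theorems.PIDim4

end
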